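import Mathlib.FieldTheory.LinearDisjoint
import Mathlib.FieldTheory.IntermediateField.Adjoin.Algebra
import Mathlib.RingTheory.Algebraic.Integral
import Mathlib.RingTheory.Localization.Module
import Mathlib.RingTheory.Etale.Descent
import Mathlib.RingTheory.Flat.FaithfullyFlat.Basic
import HarnessLib

/-!
# Descent of smoothness from the perfect closure: the algebraic lemmas

Topic: `Literature/AlgebraicGeometry/Resolution`. Second step of the tree's programme to
discharge the named fact `Temkin2013CurveSmoothing` (`InseparableLocalUniformizationCurvesStepOne.lean`:
Görtz–Wedhorn, *Algebraic Geometry II*, Lemma 26.43 (1), in the affine form used by M. Temkin,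
*Inseparable local uniformization*, J. Algebra 373 (2013), proof of Thm. 3.3.1, Step 1): a curve
becomes smooth after a finite purely inseparable extension of the ground field and
normalization. The first step, "a normal curve over a perfect field is smooth", is
`NormalCurvesOverPerfectFields.lean`; it applies over the perfect closure `k'` of the ground
field. The printed proof then invokes "a standard limit argument" (loc. cit., p. 706) to come
down from `k'` to a FINITE purely inseparable extension. This file PROVES, from Mathlib, the
self-contained algebraic lemmas on which the tree's version of that limit argument rests (all
folklore; none is in Mathlib in this form):

* `CurveSmoothing.linearIndependent_pow_of_transcendental` — the powers of a transcendental
  element are linearly independent.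
* `CurveSmoothing.linearDisjoint_adjoin_simple_of_transcendental` — **an algebraic extension
  `A/F` and a simple transcendental extension `F(t)` are linearly disjoint over `F`** (so
  `[A(t) : F(t)] = [A : F]`): `t` stays transcendental over `A`
  (`Transcendental.extendScalars`), so `F[t]` and `A` are linearly disjoint, and an `F`-basis of
  `A` is `F[t]`-free, hence `F(t)`-free (`LinearIndependent.iff_fractionRing`).
* `CurveSmoothing.linearDisjoint_of_linearDisjoint_adjoin` — **transitivity**: if `A/F` is
  algebraic, `A ⟂_F M` and `M(A) ⟂_M L`, then `A ⟂_F L` (an `F`-basis of `A` is an `M`-basis of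
  `M(A) = M·A`).
* `CurveSmoothing.smooth_of_linearDisjoint_of_sup_eq` — **descent of smoothness along a linearly
  disjoint extension of the ground field**: for `l`-subalgebras `A, B ⊆ Ω` linearly disjoint
  over the field `l` whose compositum `A ⊔ B` is a smooth `A`-algebra, `B` is a smooth
  `l`-algebra (`A ⊗ₗ B ≅ A ⊔ B`, `Subalgebra.LinearDisjoint.mulMap`, and faithfully flat descent
  of smoothness, `Algebra.Smooth.of_smooth_tensorProduct_of_faithfullyFlat`).
* `CurveSmoothing.smooth_of_ringEquiv_of_ringEquiv` — smoothness is invariant under a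
  simultaneous isomorphism of base ring and algebra (used to pass between two presentations of
  the same level of the purely inseparable tower).

In the application (next files of the programme) `l` is a finite level of the perfect closure
`k'/k`, `A = k'`, `B = Nr_{lK}(l[s])`, `A ⊔ B = Nr_{k'K}(k'[s])`; linear disjointness of `k'`
and `lK` over `l` for `l` large is obtained from the transitivity lemma with `M = l(t)`, the
lemma on `F(t)`, and a stabilization of the degrees `[lK : l(t)]` along the tower.

## Sources

* U. Görtz, T. Wedhorn, *Algebraic Geometry II*, Springer (2023), Lemma 26.43 (1) and its proof
  ("Now the claim follows from a standard limit argument", p. 706).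
* M. Temkin, *Inseparable local uniformization*, J. Algebra 373 (2013) 65–119 =
  arXiv:0804.1554v3, proof of Thm. 3.3.1, Step 1 (pp. 44–45).
* N. Bourbaki, *Algèbre*, Ch. V, §14 (linear disjointness; algebraic and purely transcendental
  extensions are linearly disjoint) — classical background, not needed as input.
-/

noncomputable section

open Polynomial TensorProduct
open scoped IntermediateField

namespace Literature.AlgebraicGeometry.Resolution

namespace CurveSmoothing

universe u v

/-! ### Powers of a transcendental element -/

/-- The powers of a transcendental element are linearly independent. [folklore] -/
theorem linearIndependent_pow_of_transcendental {F : Type u} {E : Type v} [CommRing F] [Ring E]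
    [Algebra F E] {t : E} (ht : Transcendental F t) :
    LinearIndependent F (fun n : ℕ => t ^ n) := by
  classical
  rw [linearIndependent_iff']
  intro s g hsum n hn
  let p : F[X] := ∑ i ∈ s, Polynomial.monomial i (g i)
  have hp : Polynomial.aeval t p = 0 := by
    simp only [p, map_sum, Polynomial.aeval_monomial, ← Algebra.smul_def]
    exact hsum
  have hp0 : p = 0 := by
    by_contra h
    exact ht ⟨p, h, hp⟩
  have : p.coeff n = g n := by
    simp only [p, Polynomial.finsetSum_coeff, Polynomial.coeff_monomial]
    rw [Finset.sum_ite_eq' s n g]  -- ∑ i ∈ s, if i = n then g i else 0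
    simp [hn]
  rw [← this, hp0, Polynomial.coeff_zero]

/-! ### Algebraic and purely transcendental extensions are linearly disjoint -/

section AT

variable {F : Type u} {E : Type v} [Field F] [Field E] [Algebra F E]

open scoped IntermediateField.algebraAdjoinAdjoin in
/-- **An algebraic extension and a simple transcendental extension are linearly disjoint**: if
`A/F` is algebraic (inside `E`) and `t ∈ E` is transcendental over `F`, then `A` and `F(t)`
are linearly disjoint over `F` (equivalently `[A(t) : F(t)] = [A : F]` when `A/F` is finite).
Proof: `t` stays transcendental over `A`, so the `F`-basis `(tⁿ)` of `F[t]` is `A`-linearly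
independent, i.e. `F[t]` and `A` are linearly disjoint; by symmetry an `F`-basis of `A` is
`F[t]`-linearly independent, hence `F(t) = Frac F[t]`-linearly independent. [folklore] -/
theorem linearDisjoint_adjoin_simple_of_transcendental (A : IntermediateField F E)
    [Algebra.IsAlgebraic F A] {t : E} (ht : Transcendental F t) :
    A.LinearDisjoint F⟮t⟯ := by
  classical
  have ht' : Transcendental A t := ht.extendScalars A
  -- the `F`-basis `tⁿ` of `F[t]`
  let R₀ : Subalgebra F E := Algebra.adjoin F {t}
  let e : F[X] ≃ₐ[F] R₀ := Polynomial.algEquivOfTranscendental F t ht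
  let b : Module.Basis ℕ F R₀ := (Polynomial.basisMonomials F).map e.toLinearEquiv
  have hb : ∀ n, (b n : E) = t ^ n := by
    intro n
    simp only [b, Module.Basis.map_apply, Polynomial.coe_basisMonomials,
      AlgEquiv.toLinearEquiv_apply, ← Polynomial.X_pow_eq_monomial, map_pow, e,
      SubmonoidClass.coe_pow]
    rw [Polynomial.algEquivOfTranscendental_apply, Polynomial.aeval_X]
  -- `F[t]` and `A` are linearly disjoint
  have H1 : R₀.LinearDisjoint A.toSubalgebra := by
    refine Subalgebra.LinearDisjoint.of_basis_left R₀ A.toSubalgebra b ?_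
    have : (R₀.val ∘ b : ℕ → E) = fun n => t ^ n := funext hb
    rw [this]
    exact linearIndependent_pow_of_transcendental ht'
  have H2 : A.toSubalgebra.LinearDisjoint R₀ := H1.symm
  -- an `F`-basis of `A` is `F[t]`-, hence `F(t)`-linearly independent
  let a := Module.Free.chooseBasis F A
  refine IntermediateField.LinearDisjoint.of_basis_left a ?_
  have h3 : LinearIndependent R₀ (A.val ∘ a) :=
    H2.linearIndependent_left_of_flat a.linearIndependent
  exact (LinearIndependent.iff_fractionRing R₀ F⟮t⟯).mp h3

end AT

/-! ### Transitivity of linear disjointness through an intermediate base field -/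

section transitivity

variable {F : Type u} {E : Type v} [Field F] [Field E] [Algebra F E]

/-- **Transitivity of linear disjointness.** Let `A/F` be algebraic inside `E`, `M` an
intermediate field of `E/F` and `L` an intermediate field of `E/M`. If `A` and `M` are linearly
disjoint over `F`, and `M(A) = M·A` and `L` are linearly disjoint over `M`, then `A` and `L` are
linearly disjoint over `F`: an `F`-basis of `A` is an `M`-basis of `M·A`, hence `L`-linearly
independent. [folklore] -/
theorem linearDisjoint_of_linearDisjoint_adjoin (A M : IntermediateField F E)
    [Algebra.IsAlgebraic F A] (L : IntermediateField M E) (H1 : A.LinearDisjoint M)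
    (H2 : (IntermediateField.adjoin M (A : Set E)).LinearDisjoint L) :
    A.toSubalgebra.LinearDisjoint (L.toSubalgebra.restrictScalars F) := by
  classical
  let a := Module.Free.chooseBasis F A
  -- the `F`-basis of `A` is `M`-linearly independent …
  have h1 : LinearIndependent M (A.val ∘ a) := H1.linearIndependent_left a.linearIndependent
  let AM : IntermediateField M E := IntermediateField.adjoin M (A : Set E)
  let a' : Module.Free.ChooseBasisIndex F A → AM :=
    fun i => ⟨a i, IntermediateField.subset_adjoin M _ (a i).2⟩
  have ha' : (AM.val ∘ a' : _ → E) = A.val ∘ a := rfl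
  have h1' : LinearIndependent M a' :=
    LinearIndependent.of_comp AM.val.toLinearMap (by exact h1)
  -- … and spans `M(A) = M·A`
  have halg : ∀ x ∈ (A : Set E), IsAlgebraic M x := fun x hx =>
    ((Algebra.IsAlgebraic.isAlgebraic (⟨x, hx⟩ : A)).algebraMap (A := E)).extendScalars
      (algebraMap F M).injective
  have hspanE : (A : Set E) ⊆ Submodule.span M (Set.range (A.val ∘ a)) := by
    intro x hx
    have hx' : (⟨x, hx⟩ : A) ∈ Submodule.span F (Set.range a) := by
      rw [a.span_eq]; trivial
    have := Submodule.apply_mem_span_image_of_mem_span (A.val.toLinearMap) hx'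
    rw [← Set.range_comp] at this
    exact Submodule.span_le_restrictScalars F M _ this
  have hspan : ⊤ ≤ Submodule.span M (Set.range a') := by
    rintro y -
    have hy : (y : E) ∈ Subalgebra.toSubmodule (Algebra.adjoin M (A : Set E)) := by
      rw [← IntermediateField.adjoin_toSubalgebra_of_isAlgebraic halg]
      exact y.2
    rw [Algebra.adjoin_eq_span] at hy
    have hcl : (Submonoid.closure (A : Set E) : Set E) = A := by
      refine le_antisymm (Submonoid.closure_le.mpr ?_) Submonoid.subset_closure
      exact fun z hz => hz
    rw [hcl] at hy
    have hy' : (y : E) ∈ Submodule.span M (Set.range (A.val ∘ a)) :=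
      (Submodule.span_le.mpr hspanE) hy
    rw [← ha', Set.range_comp] at hy'
    exact (Submodule.apply_mem_span_image_iff_mem_span
      (show Function.Injective AM.val.toLinearMap from Subtype.val_injective)).mp hy'
  let b : Module.Basis _ M AM := Module.Basis.mk h1' hspan
  have hb : (AM.val ∘ b : _ → E) = A.val ∘ a := by
    rw [← ha']
    exact congrArg (AM.val ∘ ·) (Module.Basis.coe_mk h1' hspan)
  -- hence `L`-linearly independent
  have h2 : LinearIndependent L (AM.val ∘ b) := H2.linearIndependent_left b.linearIndependent
  rw [hb] at h2
  -- restate over the `F`-subalgebra `L` of `E`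
  refine Subalgebra.LinearDisjoint.of_basis_left A.toSubalgebra (L.toSubalgebra.restrictScalars F)
    a ?_
  have h3 := h2.map_of_injective_injective
    (fun r : ↥(L.toSubalgebra.restrictScalars F) => (⟨r.1, r.2⟩ : L)) (AddMonoidHom.id E)
    (fun r hr => Subtype.ext (congrArg Subtype.val hr)) (fun _ h => h) (fun _ _ => rfl)
  exact h3

end transitivity

/-! ### Descent of smoothness along a linearly disjoint field extension -/

section descent

variable {l : Type u} {Ω : Type u} [Field l] [CommRing Ω] [Nontrivial Ω] [Algebra l Ω]

/-- **Descent of smoothness** (affine form used for curves): let `A, B ⊆ Ω` be `l`-subalgebras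
with `A` and `B` linearly disjoint over the field `l` (so `A ⊗ₗ B ≅ A·B`), and suppose the
compositum `A ⊔ B` is (the restriction of scalars of) a smooth `A`-algebra `B'`. Then `B` is a
smooth `l`-algebra: `A ⊗ₗ B ≅ B'` is `A`-smooth and `l → A` is faithfully flat, so smoothness
descends (`Algebra.Smooth.of_smooth_tensorProduct_of_faithfullyFlat`). [folklore] -/
theorem smooth_of_linearDisjoint_of_sup_eq (A B : Subalgebra l Ω) (B' : Subalgebra A Ω)
    (hLD : A.LinearDisjoint B) (hsup : A ⊔ B = B'.restrictScalars l)
    (hB' : Algebra.Smooth A B') : Algebra.Smooth l B := by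
  haveI : Module.FaithfullyFlat l A := inferInstance
  -- `A ⊗ₗ B ≅ A ⊔ B = B'` as `l`-algebras
  let e₀ : A ⊗[l] B ≃ₐ[l] ↥(A ⊔ B) := hLD.mulMap
  let e₁ : ↥(A ⊔ B) ≃ₐ[l] ↥(B'.restrictScalars l) := Subalgebra.equivOfEq _ _ hsup
  let e : A ⊗[l] B ≃ₐ[l] B' := e₀.trans e₁
  have he : ∀ (a : A) (b : B), (e (a ⊗ₜ b) : Ω) = (a : Ω) * b := fun a b => rfl
  -- … and as `A`-algebras
  let e' : A ⊗[l] B ≃ₐ[A] B' := AlgEquiv.ofRingEquiv (f := e.toRingEquiv) fun a => by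
    apply Subtype.ext
    show (e (algebraMap A (A ⊗[l] B) a) : Ω) = a
    rw [Algebra.TensorProduct.algebraMap_apply, Algebra.algebraMap_self, RingHom.id_apply, he]
    simp
  haveI : Algebra.Smooth A (A ⊗[l] B) :=
    ⟨Algebra.FormallySmooth.of_equiv e'.symm, Algebra.FinitePresentation.equiv e'.symm⟩
  exact Algebra.Smooth.of_smooth_tensorProduct_of_faithfullyFlat (T := A)

end descent

/-! ### Transport of smoothness along an isomorphism of the base -/

section baseChange

variable {R : Type*} {R' : Type*} {A : Type*} {A' : Type*} [CommRing R] [CommRing R']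
  [CommRing A] [CommRing A'] [Algebra R A] [Algebra R' A']

/-- **Smoothness is invariant under isomorphism of pairs**: if `e : R ≃+* R'` and `f : A ≃+* A'`
are ring isomorphisms with `f (r • a) = e r • f a`, then `A` smooth over `R` implies `A'` smooth
over `R'` (pull the `R'`-structure of `A'` back to `R` along `e`; then `f` is an `R`-algebra
isomorphism, and `R → R'` being an isomorphism, hence unramified and of finite type, smoothness
and finite presentation pass from `R` to `R'`). [folklore] -/
theorem smooth_of_ringEquiv_of_ringEquiv (e : R ≃+* R') (f : A ≃+* A')
    (hf : ∀ (r : R) (a : A), f (r • a) = e r • f a) [Algebra.Smooth R A] : Algebra.Smooth R' A' := by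
  letI : Algebra R R' := e.toRingHom.toAlgebra
  letI : Algebra R A' := ((algebraMap R' A').comp e.toRingHom).toAlgebra
  haveI : IsScalarTower R R' A' := IsScalarTower.of_algebraMap_eq fun _ => rfl
  -- `f` is an `R`-algebra isomorphism for the pulled-back structure
  let f' : A ≃ₐ[R] A' := AlgEquiv.ofRingEquiv (f := f) fun r => by
    rw [Algebra.algebraMap_eq_smul_one, hf, map_one, RingHom.algebraMap_toAlgebra,
      RingHom.comp_apply, Algebra.algebraMap_eq_smul_one]
    rfl
  haveI : Algebra.Smooth R A' := Algebra.Smooth.of_equiv f'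
  -- `R → R'` is an isomorphism
  let e' : R ≃ₐ[R] R' := AlgEquiv.ofRingEquiv (f := e) fun _ => rfl
  haveI : Algebra.FormallyUnramified R R' := Algebra.FormallyUnramified.of_equiv e'
  haveI : Algebra.FiniteType R R' := Algebra.FiniteType.of_surjective e'.toAlgHom e'.surjective
  exact ⟨Algebra.FormallySmooth.of_restrictScalars (R := R) (A := R') (B := A'),
    Algebra.FinitePresentation.of_restrict_scalars_finitePresentation R R' A'⟩

end baseChange

end CurveSmoothing

end Literature.AlgebraicGeometry.Resolution

end
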